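import Mathlib
import HarnessLib
import Literature.Geometry.DiscreteGeometry.LayerShells

/-!
# Local layer-propagation lemmas for the finite-ball form of Hales, *Dense Sphere Packings* §1.3 (XIII a):
# the real arithmetic of the radii

Route `PricedLinkCensus`, crux `SoftLayerPropagation` (stmt-AtomisticToContinuum-14233), line
`Sketch`, helper file for the stub `stub_ballPropagation`: the generic real-arithmetic lemmas that
discharge the radius hypotheses of `layer_step` / `layers_up` (`…RecursionStep.lean`,
`…LayersUp.lean`) for concrete radii.

* `sqrt_three_bounds`, `layerSpacing_bounds` — decimal brackets for `√3` and `𝗁 = 2√(2/3)`;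
* `ring_hyp_of` — the ring hypothesis `hR` holds for `(ρ, R)` as soon as `6/5 ≤ ρ ≤ R` and
  `(R − √3)² < ρ² − 1` (with `t = (r² + 4 − ρ²)/4`);
* `par_hyp_of` — the parent hypothesis `hpar` holds for `(ρ, ρ′)` as soon as `6/5 ≤ ρ′ ≤ ρ`;
* `norm_sq_add_smul_frameE` — Pythagoras for a horizontal vector plus a multiple of `𝗁e₃`.

All statements are elementary ([folklore]).
-/

noncomputable section

namespace Summit.AtomisticToContinuum.Crystallization.Theorems

open Literature.Geometry.DiscreteGeometry Literature.MathematicalPhysics.StatisticalMechanics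
open RealInnerProductSpace

/-- `1.732 < √3 < 1.7321`. [folklore] -/
theorem sqrt_three_bounds : (1.732 : ℝ) < Real.sqrt 3 ∧ Real.sqrt 3 < 1.7321 := by
  constructor
  · rw [Real.lt_sqrt (by norm_num)]; norm_num
  · rw [Real.sqrt_lt' (by norm_num)]; norm_num

/-- `1.6329 < 𝗁 < 1.633`. [folklore] -/
theorem layerSpacing_bounds : (1.6329 : ℝ) < layerSpacing ∧ layerSpacing < 1.633 := by
  have h := layerSpacing_sq
  have hp := layerSpacing_pos
  constructor <;> nlinarith

/-- **The ring hypothesis from two numbers.**  If `6/5 ≤ ρ ≤ R` and `(R − √3)² < ρ² − 1`, then for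
every `r` with `ρ < r ≤ R` the number `t = (r² + 4 − ρ²)/4 > 0` satisfies `(4/3)t² < r²` and
`r² − (4t − 4) = ρ²`. [folklore] -/
theorem ring_hyp_of {ρ R : ℝ} (hρ : 6 / 5 ≤ ρ) (hρR : ρ ≤ R) (hR : (R - Real.sqrt 3) ^ 2 < ρ ^ 2 - 1) :
    ∀ r : ℝ, ρ < r → r ≤ R → ∃ t : ℝ, 0 < t ∧ 4 / 3 * t ^ 2 < r ^ 2 ∧ r ^ 2 - (4 * t - 4) ≤ ρ ^ 2 := by
  intro r hr hrR
  obtain ⟨hs1, hs2⟩ := sqrt_three_bounds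
  have hs : Real.sqrt 3 ^ 2 = 3 := sqrt_three_sq
  refine ⟨(r ^ 2 + 4 - ρ ^ 2) / 4, by nlinarith, ?_, by linarith⟩
  -- `(r − √3)² < ρ² − 1` by convexity on `[ρ, R]`
  have key : (r - Real.sqrt 3) ^ 2 < ρ ^ 2 - 1 := by
    rcases le_or_gt (r + ρ) (2 * Real.sqrt 3) with h | h
    · have h1 : (r - Real.sqrt 3) ^ 2 ≤ (ρ - Real.sqrt 3) ^ 2 := by nlinarith
      have h2 : (ρ - Real.sqrt 3) ^ 2 < ρ ^ 2 - 1 := by nlinarith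
      linarith
    · have h1 : (r - Real.sqrt 3) ^ 2 ≤ (R - Real.sqrt 3) ^ 2 := by nlinarith
      linarith
  have hx0 : 0 < r ^ 2 + 4 - ρ ^ 2 := by nlinarith
  have hx : r ^ 2 + 4 - ρ ^ 2 < 2 * Real.sqrt 3 * r := by nlinarith
  have hx2 : (r ^ 2 + 4 - ρ ^ 2) ^ 2 < (2 * Real.sqrt 3 * r) ^ 2 := by
    exact pow_lt_pow_left₀ hx hx0.le two_ne_zero
  nlinarith

/-- **The parent hypothesis from two numbers.**  If `6/5 ≤ ρ′ ≤ ρ` then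
`r² − 2M + 4/3 ≤ ρ²` whenever `0 ≤ r ≤ ρ′`, `0 ≤ M`, `r² ≤ 3M²` (`M ≥ r/√3`, and
`r² − 2r/√3 + 4/3 ≤ max (4/3) ρ′²`). [folklore] -/
theorem par_hyp_of {ρ ρ' : ℝ} (hρ' : 6 / 5 ≤ ρ') (hle : ρ' ≤ ρ) :
    ∀ r M : ℝ, 0 ≤ r → r ≤ ρ' → 0 ≤ M → r ^ 2 ≤ 3 * M ^ 2 → r ^ 2 - 2 * M + 4 / 3 ≤ ρ ^ 2 := by
  intro r M hr0 hr hM0 hM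
  obtain ⟨hs1, hs2⟩ := sqrt_three_bounds
  have hs : Real.sqrt 3 ^ 2 = 3 := sqrt_three_sq
  -- `√3 M ≥ r`
  have h1 : r ≤ Real.sqrt 3 * M := by
    have : r ^ 2 ≤ (Real.sqrt 3 * M) ^ 2 := by rw [mul_pow, hs]; linarith
    exact (pow_le_pow_iff_left₀ hr0 (by positivity) two_ne_zero).1 this
  have hρ2 : ρ' ^ 2 ≤ ρ ^ 2 := pow_le_pow_left₀ (by linarith) hle 2
  rcases le_or_gt r (6 / 5) with h | h
  · nlinarith
  · nlinarith

/-- **Pythagoras in the frame**: for a horizontal `x` and a real `t`,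
`‖x + t 𝗁e₃‖² = ‖x‖² + (8/3) t²`. [folklore] -/
theorem norm_sq_add_smul_frameE {x : EuclideanSpace ℝ (Fin 3)} (hx : x 2 = 0) (t : ℝ) :
    ‖x + t • layerNormal layerSpacing‖ ^ 2 = ‖x‖ ^ 2 + 8 / 3 * t ^ 2 := by
  rw [norm_sq_fin3, norm_sq_fin3]
  simp only [PiLp.add_apply, PiLp.smul_apply, smul_eq_mul, frameE_apply_zero, frameE_apply_one,
    frameE_apply_two, hx, mul_zero, add_zero, zero_add]
  rw [mul_pow, layerSpacing_sq]; ring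

/-- A vector splits into its horizontal part and a multiple of `𝗁e₃`, with Pythagoras:
`‖y‖² = ‖y − (y₂/𝗁) 𝗁e₃‖² + y₂²`. [folklore] -/
theorem norm_sq_eq_horizontal_add (y : EuclideanSpace ℝ (Fin 3)) :
    ‖y‖ ^ 2 = ‖y - (y 2 / layerSpacing) • layerNormal layerSpacing‖ ^ 2 + (y 2) ^ 2 := by
  have h := layerSpacing_pos.ne'
  have h0 : (y - (y 2 / layerSpacing) • layerNormal layerSpacing) 2 = 0 := by
    simp [h]
  have e : y = (y - (y 2 / layerSpacing) • layerNormal layerSpacing) + (y 2 / layerSpacing) • layerNormal layerSpacing := by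
    abel
  conv_lhs => rw [e]
  rw [norm_sq_add_smul_frameE h0, div_pow, layerSpacing_sq]
  field_simp

/-- The height is at most the norm: `|y₂| ≤ ‖y‖`, in squared form. [folklore] -/
theorem sq_apply_two_le_norm_sq (y : EuclideanSpace ℝ (Fin 3)) : (y 2) ^ 2 ≤ ‖y‖ ^ 2 := by
  rw [norm_sq_eq_horizontal_add y]
  nlinarith [norm_nonneg (y - (y 2 / layerSpacing) • layerNormal layerSpacing)]

/-! ### The three radius schedules -/

/-- `√2 ≤ 3/2`. [folklore] -/
theorem sqrt_two_le : Real.sqrt 2 ≤ 3 / 2 := by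
  rw [Real.sqrt_le_left (by norm_num)]; norm_num

/-- Numeric far-corner inequality from a decimal gap: `P + 4/√3 ≤ R` if `R − P ≥ 2.3095`. [folklore] -/
theorem far_of_gap {P R : ℝ} (h : 2.3095 ≤ R - P) : P + 4 / Real.sqrt 3 ≤ R := by
  obtain ⟨hs1, hs2⟩ := sqrt_three_bounds
  have h3 : (0 : ℝ) < Real.sqrt 3 := by linarith
  have : 4 / Real.sqrt 3 ≤ 2.3095 := by
    rw [div_le_iff₀ h3]; nlinarith
  linarith

/-- Numeric ring inequality from decimals: `(R − √3)² < P² − 1` if `R² − 3.464 R + 4 < P²` and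
`1.8 ≤ R`. [folklore] -/
theorem ring_ineq_of {P R : ℝ} (hR : 1.8 ≤ R) (h : R ^ 2 - 3.464 * R + 4 < P ^ 2) :
    (R - Real.sqrt 3) ^ 2 < P ^ 2 - 1 := by
  obtain ⟨hs1, hs2⟩ := sqrt_three_bounds
  have hs : Real.sqrt 3 ^ 2 = 3 := sqrt_three_sq
  nlinarith

/-- A square on an interval is bounded by its values at the endpoints. [folklore] -/
theorem sq_sub_le_of_mem_Icc {m a lo hi B : ℝ} (hlo : lo ≤ a) (hhi : a ≤ hi)
    (h1 : (m - lo) ^ 2 ≤ B) (h2 : (m - hi) ^ 2 ≤ B) : (m - a) ^ 2 ≤ B := by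
  rcases le_or_gt 0 (2 * m - a - lo) with h | h
  · have : (m - a) ^ 2 ≤ (m - lo) ^ 2 := by nlinarith
    linarith
  · have : (m - a) ^ 2 ≤ (m - hi) ^ 2 := by nlinarith
    linarith

/-- **The schedule above the base (Case A).**  Radii `P n` (certified discs) and `R n` (rings) for
the layers `0 ≤ n ≤ 9` above an HCP base disc of radius `10.6`, with all the real-arithmetic facts
the reconstruction uses: the hypotheses of `layers_up` (`√2 ≤ P`, ring, parent, far corner, the
pattern ball `13` about the moved centre at height `a′𝗁`, `0 ≤ a′ ≤ 4.5931`, for the layers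
`n + 1 ≤ a′ + 5.2443` that meet the `8.564`-ball) and the coverage of the `8.564`-ball by the rings.
[folklore] -/
theorem exists_up_schedule : ∃ P R : ℕ → ℝ, P 0 = 10.6 ∧
    (∀ n ≤ 9, Real.sqrt 2 ≤ P n) ∧
    (∀ n ≤ 9, ∀ r : ℝ, P n < r → r ≤ R n →
      ∃ t : ℝ, 0 < t ∧ 4 / 3 * t ^ 2 < r ^ 2 ∧ r ^ 2 - (4 * t - 4) ≤ P n ^ 2) ∧
    (∀ n < 9, ∀ r M : ℝ, 0 ≤ r → r ≤ P (n + 1) → 0 ≤ M → r ^ 2 ≤ 3 * M ^ 2 →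
      r ^ 2 - 2 * M + 4 / 3 ≤ P n ^ 2) ∧
    (∀ n < 9, P (n + 1) + 4 / Real.sqrt 3 ≤ R n) ∧
    (∀ n : ℕ, n < 9 → ∀ a x : ℝ, 0 ≤ a → a ≤ 4.5931 → (n : ℝ) + 1 ≤ a + 5.2443 → x ≤ P (n + 1) →
      0 ≤ x → x ^ 2 + 8 / 3 * ((n : ℝ) + 1 - a) ^ 2 ≤ 169) ∧
    (∀ k : ℕ, k ≤ 9 → ∀ a x : ℝ, 0 ≤ a → a ≤ 4.5931 → (k : ℝ) ≤ a + 5.2443 →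
      x + 8 / 3 * ((k : ℝ) - a) ^ 2 ≤ 73.34 → x ≤ R k ^ 2) := by
  refine ⟨fun n => (([10.6, 9.965, 9.327, 8.685, 8.039, 7.389, 6.733, 6.07, 5.399, 4.718] : List ℝ).getD n 0),
    fun n => (([12.279, 11.641, 11.0, 10.354, 9.703, 9.048, 8.385, 7.714, 7.032, 6.337] : List ℝ).getD n 0),
    by norm_num, ?_, ?_, ?_, ?_, ?_, ?_⟩
  · intro n hn
    have hs2 := sqrt_two_le
    interval_cases n <;> norm_num <;> linarith
  · intro n hn
    refine ring_hyp_of ?_ ?_ (ring_ineq_of ?_ ?_) <;> interval_cases n <;> norm_num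
  · intro n hn
    refine par_hyp_of ?_ ?_ <;> interval_cases n <;> norm_num
  · intro n hn
    refine far_of_gap ?_
    interval_cases n <;> norm_num
  · intro n hn a x ha0 ha hna hx hx0
    have hx2 : x ^ 2 ≤ (([10.6, 9.965, 9.327, 8.685, 8.039, 7.389, 6.733, 6.07, 5.399, 4.718] : List ℝ).getD (n + 1) 0) ^ 2 :=
      pow_le_pow_left₀ hx0 hx 2
    interval_cases n <;> norm_num at hx2 hna ⊢ <;> nlinarith [mul_nonneg ha0 (sub_nonneg.2 ha), mul_nonneg (sub_nonneg.2 hna) (sub_nonneg.2 ha), mul_nonneg (sub_nonneg.2 hna) ha0]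
  · intro k hk a x ha0 ha hka hx
    interval_cases k <;> norm_num at hka hx ⊢ <;> nlinarith [mul_nonneg ha0 (sub_nonneg.2 ha), mul_nonneg (sub_nonneg.2 hka) (sub_nonneg.2 ha), sq_nonneg ((k : ℝ) - a)]

/-- **The schedule below the base (Case A)**: radii for the layers `1 ≤ n ≤ 5` below the HCP base
disc (layer `−n`), with the hypotheses of `layers_down` and the coverage of the rings. [folklore] -/
theorem exists_down_schedule : ∃ P R : ℕ → ℝ, P 0 = 10.6 ∧
    (∀ n ≤ 5, Real.sqrt 2 ≤ P n) ∧
    (∀ n ≤ 5, ∀ r : ℝ, P n < r → r ≤ R n →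
      ∃ t : ℝ, 0 < t ∧ 4 / 3 * t ^ 2 < r ^ 2 ∧ r ^ 2 - (4 * t - 4) ≤ P n ^ 2) ∧
    (∀ n < 5, ∀ r M : ℝ, 0 ≤ r → r ≤ P (n + 1) → 0 ≤ M → r ^ 2 ≤ 3 * M ^ 2 →
      r ^ 2 - 2 * M + 4 / 3 ≤ P n ^ 2) ∧
    (∀ n < 5, P (n + 1) + 4 / Real.sqrt 3 ≤ R n) ∧
    (∀ n : ℕ, n < 5 → ∀ a x : ℝ, 0 ≤ a → (n : ℝ) + 1 ≤ 5.2443 - a → x ≤ P (n + 1) →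
      0 ≤ x → x ^ 2 + 8 / 3 * ((n : ℝ) + 1 + a) ^ 2 ≤ 169) ∧
    (∀ k : ℕ, k ≤ 5 → ∀ a x : ℝ, x + 8 / 3 * ((k : ℝ) + a) ^ 2 ≤ 73.34 → x ≤ R k ^ 2) := by
  refine ⟨fun n => (([10.6, 9.7, 9.06, 8.417, 7.77, 7.118] : List ℝ).getD n 0),
    fun n => (([12.279, 11.375, 10.731, 10.084, 9.432, 8.774] : List ℝ).getD n 0),
    by norm_num, ?_, ?_, ?_, ?_, ?_, ?_⟩
  · intro n hn
    have hs2 := sqrt_two_le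
    interval_cases n <;> norm_num <;> linarith
  · intro n hn
    refine ring_hyp_of ?_ ?_ (ring_ineq_of ?_ ?_) <;> interval_cases n <;> norm_num
  · intro n hn
    refine par_hyp_of ?_ ?_ <;> interval_cases n <;> norm_num
  · intro n hn
    refine far_of_gap ?_
    interval_cases n <;> norm_num
  · intro n hn a x ha0 hna hx hx0
    have hx2 : x ^ 2 ≤ (([10.6, 9.7, 9.06, 8.417, 7.77, 7.118] : List ℝ).getD (n + 1) 0) ^ 2 :=
      pow_le_pow_left₀ hx0 hx 2
    interval_cases n <;> norm_num at hx2 hna ⊢ <;> nlinarith [mul_nonneg ha0 (sub_nonneg.2 hna)]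
  · intro k hk a x hx
    interval_cases k <;> norm_num at hx ⊢ <;> nlinarith [sq_nonneg ((k : ℝ) + a)]

/-- **The schedule about an FCC centre (Case B)**: radii for the layers `0 ≤ n ≤ 5` above (and, by
symmetry, below) the FCC base disc of radius `15/2` through the centre of the ball, the first two
layers inside the FCC zone (the `15/2`-ball), the others with the far corner. [folklore] -/
theorem exists_fcc_schedule : ∃ P R : ℕ → ℝ, P 0 = 15 / 2 ∧
    (∀ n ≤ 5, Real.sqrt 2 ≤ P n) ∧
    (∀ n ≤ 5, ∀ r : ℝ, P n < r → r ≤ R n →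
      ∃ t : ℝ, 0 < t ∧ 4 / 3 * t ^ 2 < r ^ 2 ∧ r ^ 2 - (4 * t - 4) ≤ P n ^ 2) ∧
    (∀ n < 5, ∀ r M : ℝ, 0 ≤ r → r ≤ P (n + 1) → 0 ≤ M → r ^ 2 ≤ 3 * M ^ 2 →
      r ^ 2 - 2 * M + 4 / 3 ≤ P n ^ 2) ∧
    (∀ n : ℕ, 2 ≤ n → n < 5 → P (n + 1) + 4 / Real.sqrt 3 ≤ R n) ∧
    (∀ n : ℕ, n < 2 → ∀ x : ℝ, x ≤ P (n + 1) → 0 ≤ x → x ^ 2 + 8 / 3 * ((n : ℝ) + 1) ^ 2 ≤ (15 / 2) ^ 2) ∧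
    (∀ n : ℕ, n < 5 → ∀ x : ℝ, x ≤ P (n + 1) → 0 ≤ x → x ^ 2 + 8 / 3 * ((n : ℝ) + 1) ^ 2 ≤ 169) ∧
    (∀ k : ℕ, k ≤ 5 → ∀ x : ℝ, x + 8 / 3 * (k : ℝ) ^ 2 ≤ 73.34 → x ≤ R k ^ 2) := by
  refine ⟨fun n => (([7.5, 7.3, 6.7, 6.037, 5.366, 4.684] : List ℝ).getD n 0),
    fun n => (([9.16, 8.958, 8.351, 7.68, 6.998, 6.303] : List ℝ).getD n 0),
    by norm_num, ?_, ?_, ?_, ?_, ?_, ?_, ?_⟩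
  · intro n hn
    have hs2 := sqrt_two_le
    interval_cases n <;> norm_num <;> linarith
  · intro n hn
    refine ring_hyp_of ?_ ?_ (ring_ineq_of ?_ ?_) <;> interval_cases n <;> norm_num
  · intro n hn
    refine par_hyp_of ?_ ?_ <;> interval_cases n <;> norm_num
  · intro n hn2 hn
    refine far_of_gap ?_
    interval_cases n <;> norm_num
  · intro n hn x hx hx0
    have hx2 : x ^ 2 ≤ (([7.5, 7.3, 6.7, 6.037, 5.366, 4.684] : List ℝ).getD (n + 1) 0) ^ 2 :=
      pow_le_pow_left₀ hx0 hx 2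
    interval_cases n <;> norm_num at hx2 ⊢ <;> nlinarith
  · intro n hn x hx hx0
    have hx2 : x ^ 2 ≤ (([7.5, 7.3, 6.7, 6.037, 5.366, 4.684] : List ℝ).getD (n + 1) 0) ^ 2 :=
      pow_le_pow_left₀ hx0 hx 2
    interval_cases n <;> norm_num at hx2 ⊢ <;> nlinarith
  · intro k hk x hx
    interval_cases k <;> norm_num at hx ⊢ <;> linarith

/-- The squared radius of the ball that the rings must cover: `(7 + √22/3)² ≤ 73.34`. [folklore] -/
theorem seven_add_sqrt_sq_le : (7 + Real.sqrt 22 / 3) ^ 2 ≤ 73.34 := by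
  have h1 : Real.sqrt 22 < 4.6905 := by
    rw [Real.sqrt_lt' (by norm_num)]; norm_num
  have h2 : 0 ≤ Real.sqrt 22 := Real.sqrt_nonneg _
  have h3 : Real.sqrt 22 ^ 2 = 22 := Real.sq_sqrt (by norm_num)
  nlinarith

/-- **Registered sub-goal `ballPropagation_ringHypOf`** of the crux item (the ring hypothesis from
two numbers, in closed form: `ring_hyp_of`). [folklore] -/
theorem ballPropagation_ringHypOf :
    ∀ (ρ R : ℝ), 6 / 5 ≤ ρ → ρ ≤ R → (R - Real.sqrt 3) ^ 2 < ρ ^ 2 - 1 → ∀ r : ℝ, ρ < r → r ≤ R →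
      ∃ t : ℝ, 0 < t ∧ 4 / 3 * t ^ 2 < r ^ 2 ∧ r ^ 2 - (4 * t - 4) ≤ ρ ^ 2 :=
  fun _ _ hρ hρR hR => ring_hyp_of hρ hρR hR

end Summit.AtomisticToContinuum.Crystallization.Theorems

end
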